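import Summits.QuantumFields.BalabanUV.Beta.GAN24.DerivativeRateTransferStraightenJet
import Literature.MathematicalPhysics.QuantumFieldTheory.Balaban1983to89.B9SectECov

/-!
# `BalabanUV.Beta.GAN24.DerivativeRateTransferNoLegs` — binder row G-an2-4 ∕ (CONV-C), route R6 «VALUES, NOT DERIVATIVES», PART 41:
# THE EXACT ONE-STEP SPLIT OF THE EFFECTIVE FORMS — `𝒮(H′, Q·q) − 𝒮(H, Q) = ℋᴸ(H,Q)·(𝒮(H′,q) − H)·(q·ℋ(H′, Q·q))`: the tower step is the
# one-step FORM DEFECT `D := 𝒮(H′,q) − H` sandwiched between the coarse left minimiser and the averaged fine minimiser — an IDENTITY over any field,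
# no symmetry, no invertibility of the fine forms, NO LEGS (unit b2b-balaban-gan24-p3, gen 39; gan24-idea-1 g48's lens item 5 «NL split», scratch
# `records-g48/sketch/NoLegsSplitSketch.lean` ac8b46c14c0663c3, re-typed with credit at its first refusal (W-idea1-g48-1))

NOT IN PRINT; OUR PROOF (for the ROUTE; [folklore] block algebra — an2's bordered letters `effForm ∕ minOp ∕ minOpL ∕ kkt`, `kkt_mul_blocks`, `blocks_mul_kkt`,
`effForm_compForm`, `minOp_compForm` BY NAME, `B9SectECov.compForm_zero` BY NAME; an1's `Envelope.value_sub_value` is the invertible-form ancestor of §1).  HONEST FRAMING (cell contract, verbatim):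
«discharging `BetaPertH` makes Bałaban's UV stability UNCONDITIONAL — a real constructive-QFT result; it is NOT the continuum limit and NOT the Clay problem.»
HONEST DEPENDENCY (verbatim): «continuum YM on T⁴ ⇐ BetaPertH ∧ nine spine estimates (0/9 proved); BetaPertH ⇐ (D1) ∧ (D4) ∧ CAP+tail; G-an2-4 gates asym, D1 and NE2/3/4.»

WHY THIS FILE.  Every route-R6 END so far bounds the tower step `𝒮_{j+1} − 𝒮_j` through INEQUALITIES with legs (PART 18: (STAB) + (CONS); PART 29: (PROL) +
(ROW); PART 40: HF-1).  With `Q_{j+1} = Q_j·Qf_j` (Bałaban's composite averagings) the step is an EXACT sandwich: `𝒮(H_{j+1}, Q_j·Qf_j) − 𝒮(H_j, Q_j) =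
ℋ_jᴸ·D_j·(Qf_j·ℋ_{j+1})`, `D_j := 𝒮(H_{j+1}, Qf_j) − H_j` — the ONE-STEP FORM DEFECT (the level-(j+1) form integrated down one step, minus the level-j form) seen
between the coarse left minimiser and the one-step average of the fine minimiser; its derivative versions are Leibniz sums (`three_term_split`) with NO legs of their
own (gan24-idea-1 g48's reading: «jets are Leibniz sums; ONE SIGN `D_{j,0} ⪰ 0 ⟺ (STAB)`»).  This file types the identities; it prices nothing.

WHAT THIS FILE PROVES (0 sorry, 0 `def`, nothing cited; any field `𝕜`):
* §1 **`effForm_sub_effForm_mixed`** (`𝒮(K′,Q) − 𝒮(K,Q) = ℋᴸ(K,Q)·(K′ − K)·ℋ(K′,Q)`), **`effForm_sub_effForm_two_data`**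
  (`𝒮(H′,q′) − 𝒮(H,q) = ℋᴸ(H′ − H)ℋ′ − ℋᴸ(q′ − q)ᵀ𝒮′ − 𝒮(q′ − q)ℋ′` — the EXACT finite envelope identity; its first-order limit is PART 39 §4's `d𝒮 = ℋᵀKℋ`).
* §2 **`effForm_tower_step_sub`** (the no-legs split), `three_term_split` (Leibniz in difference form),
  **`effForm_tower_step_sub_of_symm`** (symmetric coarse form: `ℋᴸ = ℋᵀ`, so `𝒮(H′,Q·q) − 𝒮(H,Q) = ℋ(H,Q)ᵀ·D·(q·ℋ(H′,Q·q))`).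
WHAT IT DOES NOT DO: bound `D_j` or the averaged fine minimiser for any of Bałaban's operators; (STAB) ⟺ `D_{j,0} ⪰ 0` is PART 18's business.  SUPPLIER work
on route R6 (rank 2, REDUCTION, no seat); no consumer of record; NEVER «G-an2-4 closed»; NOT (CONV-C), NOT D1, NOT `BetaPertH`, NOT continuum, NOT Clay.
Records: `HOME/b2b-balaban-gan24-p3/WOODBURY-FIBRE.md` v13.9.
-/

noncomputable section

open Matrix

namespace Summit.QuantumFields.BalabanUV.Beta.GAN24.DerivativeRateTransferNoLegs

open Literature.MathematicalPhysics.QuantumFieldTheory.Balaban1983to89.Beta.Composition (kkt compForm)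
open Literature.MathematicalPhysics.QuantumFieldTheory.Balaban1983to89.Beta.CompositionSingular (effForm minOp minOpL mul_minOp kkt_mul_blocks blocks_mul_kkt
  effForm_compForm minOp_compForm minOpL_eq_transpose)
open Literature.MathematicalPhysics.QuantumFieldTheory.Balaban1983to89.B9SectECov (compForm_zero)

variable {𝕜 : Type*} [Field 𝕜]
variable {ν μ κ : Type*} [Fintype ν] [Fintype μ] [Fintype κ] [DecidableEq ν] [DecidableEq μ] [DecidableEq κ]

/-! ## §1 The mixed-minimiser and the two-data envelope identities [folklore; gan24-idea-1 g48] -/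

/-- **`effForm_sub_effForm_mixed` — THE MIXED-MINIMISER IDENTITY** [folklore; gan24-idea-1 g48; an1's `Envelope.value_sub_value` in bordered letters]: at a common
constraint map, `𝒮(K′,Q) − 𝒮(K,Q) = ℋᴸ(K,Q)·(K′ − K)·ℋ(K′,Q)` — no symmetry, no invertibility of `K, K′`, only the two bordered non-degeneracies. -/
theorem effForm_sub_effForm_mixed (K K' : Matrix ν ν 𝕜) (Q : Matrix μ ν 𝕜) (h : IsUnit (kkt K Q).det) (h' : IsUnit (kkt K' Q).det) :
    effForm K' Q - effForm K Q = minOpL K Q * (K' - K) * minOp K' Q := by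
  have L1 : minOpL K Q * K = effForm K Q * Q := (blocks_mul_kkt K Q h).2.2.1
  have L2 : minOpL K Q * Qᵀ = 1 := (blocks_mul_kkt K Q h).2.2.2
  have R1 : K' * minOp K' Q = Qᵀ * effForm K' Q := (kkt_mul_blocks K' Q h').2.1
  have R2 : Q * minOp K' Q = 1 := mul_minOp K' Q h'
  have e1 : minOpL K Q * K' * minOp K' Q = effForm K' Q := by rw [Matrix.mul_assoc, R1, ← Matrix.mul_assoc, L2, Matrix.one_mul]
  have e2 : minOpL K Q * K * minOp K' Q = effForm K Q := by rw [L1, Matrix.mul_assoc, R2, Matrix.mul_one]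
  rw [Matrix.mul_sub, Matrix.sub_mul, e1, e2]

/-- **`effForm_sub_effForm_two_data` — THE EXACT FINITE ENVELOPE IDENTITY** [folklore; gan24-idea-1 g48]: two data `(H,q)`, `(H′,q′)` with nonsingular bordered
matrices: `𝒮(H′,q′) − 𝒮(H,q) = ℋᴸ(H,q)·(H′ − H)·ℋ(H′,q′) − ℋᴸ(H,q)·(q′ − q)ᵀ·𝒮(H′,q′) − 𝒮(H,q)·(q′ − q)·ℋ(H′,q′)` (its first-order limit is PART 39 §4). -/
theorem effForm_sub_effForm_two_data (H H' : Matrix ν ν 𝕜) (q q' : Matrix μ ν 𝕜) (h : IsUnit (kkt H q).det) (h' : IsUnit (kkt H' q').det) :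
    effForm H' q' - effForm H q =
      minOpL H q * (H' - H) * minOp H' q' - minOpL H q * (q' - q)ᵀ * effForm H' q' - effForm H q * (q' - q) * minOp H' q' := by
  have L1 : minOpL H q * H = effForm H q * q := (blocks_mul_kkt H q h).2.2.1
  have L2 : minOpL H q * qᵀ = 1 := (blocks_mul_kkt H q h).2.2.2
  have R1 : H' * minOp H' q' = q'ᵀ * effForm H' q' := (kkt_mul_blocks H' q' h').2.1
  have R2 : q' * minOp H' q' = 1 := mul_minOp H' q' h'
  have e1 : minOpL H q * H' * minOp H' q' = minOpL H q * q'ᵀ * effForm H' q' := by rw [Matrix.mul_assoc, R1, ← Matrix.mul_assoc]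
  have e2 : minOpL H q * H * minOp H' q' = effForm H q * q * minOp H' q' := by rw [L1]
  have e3 : minOpL H q * qᵀ * effForm H' q' = effForm H' q' := by rw [L2, Matrix.one_mul]
  have e4 : effForm H q * q' * minOp H' q' = effForm H q := by rw [Matrix.mul_assoc, R2, Matrix.mul_one]
  rw [Matrix.transpose_sub, Matrix.mul_sub, Matrix.sub_mul, Matrix.mul_sub, Matrix.sub_mul, Matrix.mul_sub, Matrix.sub_mul, e1, e2, e3, e4]
  abel

/-! ## §2 The no-legs one-step split along the tower [folklore; gan24-idea-1 g48] -/

/-- **`effForm_tower_step_sub` — THE NO-LEGS SPLIT** [folklore; gan24-idea-1 g48]: fine form `H′` on `ν`, one-step averaging `q : ν → μ`, coarse form `H` on `μ`,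
further averaging `Q : μ → κ`; with the one-step effective form `Λ := 𝒮(H′,q)` and an2's tower laws `𝒮(H′,Q·q) = 𝒮(Λ,Q)`, `ℋ(H′,Q·q) = ℋ(H′,q)·ℋ(Λ,Q)` (`G = 0`):
`𝒮(H′, Q·q) − 𝒮(H, Q) = ℋᴸ(H,Q)·(𝒮(H′,q) − H)·(q·ℋ(H′,Q·q))` — the tower step IS the one-step form defect `D = 𝒮(H′,q) − H` in a sandwich, no legs. -/
theorem effForm_tower_step_sub (H' : Matrix ν ν 𝕜) (q : Matrix μ ν 𝕜) (H : Matrix μ μ 𝕜) (Q : Matrix κ μ 𝕜)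
    (hq : IsUnit (kkt H' q).det) (hΛ : IsUnit (kkt (effForm H' q) Q).det) (hH : IsUnit (kkt H Q).det) :
    effForm H' (Q * q) - effForm H Q = minOpL H Q * (effForm H' q - H) * (q * minOp H' (Q * q)) := by
  have hΛ0 : IsUnit (kkt (effForm H' q + 0) Q).det := by rwa [add_zero]
  have tE : effForm H' (Q * q) = effForm (effForm H' q) Q := by
    have := effForm_compForm H' q 0 Q hq hΛ0
    rwa [compForm_zero, add_zero] at this
  have tM : minOp H' (Q * q) = minOp H' q * minOp (effForm H' q) Q := by
    have := minOp_compForm H' q 0 Q hq hΛ0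
    rwa [compForm_zero, add_zero] at this
  have hqP : q * minOp H' (Q * q) = minOp (effForm H' q) Q := by rw [tM, ← Matrix.mul_assoc, mul_minOp H' q hq, Matrix.one_mul]
  rw [tE, hqP]
  exact effForm_sub_effForm_mixed H (effForm H' q) Q hH hΛ

omit [Fintype ν] [DecidableEq ν] [DecidableEq μ] [Fintype κ] [DecidableEq κ] in
/-- **`three_term_split`** [folklore; gan24-idea-1 g48]: Leibniz in difference form, `X′Y′Z′ − XYZ = (X′ − X)Y′Z′ + X(Y′ − Y)Z′ + XY(Z′ − Z)` — the derivative
versions of the no-legs split are such sums, with no legs of their own. -/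
theorem three_term_split (X X' : Matrix κ μ 𝕜) (Y Y' : Matrix μ μ 𝕜) (Z Z' : Matrix μ ν 𝕜) :
    X' * Y' * Z' - X * Y * Z = (X' - X) * Y' * Z' + X * (Y' - Y) * Z' + X * Y * (Z' - Z) := by
  simp only [Matrix.sub_mul, Matrix.mul_sub]
  abel

/-- **`effForm_tower_step_sub_of_symm`** [our proof]: with a SYMMETRIC coarse form `H` the left companion is the transpose of the minimiser (an2's
`minOpL_eq_transpose`), so `𝒮(H′, Q·q) − 𝒮(H, Q) = ℋ(H,Q)ᵀ·(𝒮(H′,q) − H)·(q·ℋ(H′, Q·q))` — route R6's tower step (`Q_{j+1} = Q_j·Qf_j`, `H_j` symmetric) is the sandwich of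
the one-step form defect `D_j = 𝒮(H_{j+1}, Qf_j) − H_j` between the level-`j` minimiser and the one-step average of the level-`(j+1)` minimiser. -/
theorem effForm_tower_step_sub_of_symm (H' : Matrix ν ν 𝕜) (q : Matrix μ ν 𝕜) (H : Matrix μ μ 𝕜) (Q : Matrix κ μ 𝕜) (hHs : Hᵀ = H)
    (hq : IsUnit (kkt H' q).det) (hΛ : IsUnit (kkt (effForm H' q) Q).det) (hH : IsUnit (kkt H Q).det) :
    effForm H' (Q * q) - effForm H Q = (minOp H Q)ᵀ * (effForm H' q - H) * (q * minOp H' (Q * q)) := by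
  rw [effForm_tower_step_sub H' q H Q hq hΛ hH, (minOpL_eq_transpose H Q hHs).1]

end Summit.QuantumFields.BalabanUV.Beta.GAN24.DerivativeRateTransferNoLegs

end
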